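import Mathlib
import HarnessLib
import Literature.Computability.AlgebraicComplexity.PatternExpressions
import Summits.ValiantsHypothesis.ValiantsHypothesis.Theorems.MonotoneRestorationOrbitCompressionQPPinnedEntryRow

/-!
# Route MonotoneRestoration — aside `OrbitCompressionQP` (stmt-ValiantsHypothesis-18332), line
# `expression_compression`: the TWO-PINNED-ENTRIES row gadget and the 2-row stratum for inner polynomials
# QUADRATIC in the second row

Second rung of the y-degree-graded attack on the 2-row stratum of `stub_narrowExpressionCompression`
(first rung: `…PinnedEntryRow.lean`).  For `H_n(t₁, t₂; r_0, …, r_{n-1})` (variables `Option (Option (Fin n))`: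
outer `none = t₁`, `some none = t₂`, `some (some j) = r_j`) a `VQP` family symmetric in `r`:

* ★★ `exists_twoPinnedEntriesRowGadget` — `(1,2)`-label pattern expressions `W_n` of quasi-polynomial length
  with `W_n.value ρ γ = H_n(x_{ρ0,γ0}, x_{ρ0,γ1}; row ρ0)`.  Same mechanism as the one-pinned gadget, with the
  slices taken in both pinned variables (`coeffEps d' (coeffEps d H)`, all symmetric, all cheap) and the
  `(D+1)²` Bläser–Jindal cores packaged as ONE `VQP` family over `Fin n ⊔ Fin (D+1)²`;
* ★ `narrowQP_twoRow_pinnedQuadratic` — the matrix-symmetric family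
  `f_n = Σ_i Σ_{b,b'} (Σ_{i'} x_{i'b} x_{i'b'}) · H_n(x_{ib}, x_{ib'}; row i) = Σ_{i,i'} g_n(row i, row i')`,
  `g_n(r, s) = Σ_{b,b'} s_b s_{b'} H_n(r_b, r_{b'}; r)` (the generic second-row-QUADRATIC column-symmetric
  inner polynomial, up to the affine and diagonal terms covered by `…PinnedEntryRow`), satisfies the
  conclusion of `stub_narrowExpressionCompression` with `(2,2)` labels.

So the rung "degree `≤ D` in the second row" of the 2-row stratum is, for each constant `D`, the
`D`-pinned-entries gadget by the same division-free method (slices → cores → package → substitute); the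
open case of the stratum is second-row degree growing with `n`.

Helper file (`--supports stmt-ValiantsHypothesis-18332`); def-free; nothing here is a named fact (Bläser–Jindal
is the tree's proved `BlaserJindal2019_thm4_holds`); no registered stub is closed; VP ≠ VNP is not moved.
-/

noncomputable section

open MvPolynomial

-- `Summit.ValiantsHypothesis.ValiantsHypothesis.…` is the tree's single-conjunct layout (Sub = Summit).
set_option linter.dupNamespace false

namespace Summit.ValiantsHypothesis.ValiantsHypothesis.Theorems

namespace FormulaSubstitution

open Literature.Computability.AlgebraicComplexity

/-- **Packaging `(D+1)²` cores as one `VQP` family**: if `D` is p-bounded, the cores `P_{n,d,d'}`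
(`d, d' ≤ D n`) have degree `≤ D n` and quasi-polynomially bounded complexity, then
`Q_n = Σ_{d,d'} w_{d,d'} · P_{n,d,d'}(y) ∈ ℂ[y ⊔ w]` is a `VQP` family. [folklore] -/
theorem isVQPFamily_packagedCores₂ (D : ℕ → ℕ) (hDp : IsPBounded D)
    (P : (n : ℕ) → ℕ → ℕ → MvPolynomial (Fin n) ℂ) (B : ℕ → ℕ) (hB : IsQPBounded B)
    (hPc : ∀ n d d', d ≤ D n → d' ≤ D n → complexity (P n d d') ≤ B n)
    (hPd : ∀ n d d', (P n d d').totalDegree ≤ D n) :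
    IsVQPFamily (fun n => ∑ dd : Fin (D n + 1) × Fin (D n + 1),
      (X (Sum.inr dd) * rename Sum.inl (P n dd.1.val dd.2.val) :
        MvPolynomial (Fin n ⊕ (Fin (D n + 1) × Fin (D n + 1))) ℂ)) := by
  classical
  refine ⟨⟨?_, ?_⟩, ?_⟩
  · have hD1 : IsPBounded fun n => D n + 1 := IsPBounded.add_holds hDp (IsPBounded.const 1)
    have h : IsPBounded fun n => n + (D n + 1) * (D n + 1) :=
      IsPBounded.add_holds IsPBounded.id (IsPBounded.mul_holds hD1 hD1)
    refine h.mono fun n => ?_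
    simp [Fintype.card_sum, Fintype.card_fin, Fintype.card_prod]
  · have h : IsPBounded fun n => D n + 1 := IsPBounded.add_holds hDp (IsPBounded.const 1)
    refine h.mono fun n => ?_
    refine (totalDegree_finsetSum _ _).trans (Finset.sup_le fun dd _ => ?_)
    calc (X (Sum.inr dd) * rename Sum.inl (P n dd.1.val dd.2.val) :
            MvPolynomial (Fin n ⊕ (Fin (D n + 1) × Fin (D n + 1))) ℂ).totalDegree
        ≤ (X (Sum.inr dd) : MvPolynomial (Fin n ⊕ (Fin (D n + 1) × Fin (D n + 1))) ℂ).totalDegree +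
            (rename Sum.inl (P n dd.1.val dd.2.val) :
              MvPolynomial (Fin n ⊕ (Fin (D n + 1) × Fin (D n + 1))) ℂ).totalDegree :=
          totalDegree_mul _ _
      _ ≤ 1 + D n := by
          refine Nat.add_le_add ?_ ((totalDegree_rename_le _ _).trans (hPd n _ _))
          rw [totalDegree_X]
      _ = D n + 1 := by omega
  · have hDq : IsQPBounded D := hDp.isQPBounded
    have hD1 : IsQPBounded fun n => D n + 1 := hDq.add (IsQPBounded.const 1)
    have hβ : IsQPBounded fun n => (D n + 1) * (D n + 1) * (B n + 2) :=
      (hD1.mul hD1).mul (hB.add (IsQPBounded.const 2))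
    refine hβ.mono fun n => ?_
    have hsum := complexity_finset_sum_le (Finset.univ : Finset (Fin (D n + 1) × Fin (D n + 1)))
      (fun dd => (X (Sum.inr dd) * rename Sum.inl (P n dd.1.val dd.2.val) :
        MvPolynomial (Fin n ⊕ (Fin (D n + 1) × Fin (D n + 1))) ℂ))
    rw [Finset.card_univ, Fintype.card_prod, Fintype.card_fin] at hsum
    have hterm : ∀ dd : Fin (D n + 1) × Fin (D n + 1),
        complexity (X (Sum.inr dd) * rename Sum.inl (P n dd.1.val dd.2.val) :
          MvPolynomial (Fin n ⊕ (Fin (D n + 1) × Fin (D n + 1))) ℂ) ≤ B n + 1 := by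
      intro dd
      refine (complexity_mul_le_holds _ _).trans ?_
      rw [complexity_X_holds]
      have h1 := complexity_rename_le_holds'
        (Sum.inl : Fin n → Fin n ⊕ (Fin (D n + 1) × Fin (D n + 1))) (P n dd.1.val dd.2.val)
      have h2 := hPc n dd.1.val dd.2.val (by have := dd.1.isLt; omega) (by have := dd.2.isLt; omega)
      omega
    have hsum' : ∑ dd : Fin (D n + 1) × Fin (D n + 1),
        complexity (X (Sum.inr dd) * rename Sum.inl (P n dd.1.val dd.2.val) :
          MvPolynomial (Fin n ⊕ (Fin (D n + 1) × Fin (D n + 1))) ℂ) ≤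
          (D n + 1) * (D n + 1) * (B n + 1) := by
      calc _ ≤ ∑ _dd : Fin (D n + 1) × Fin (D n + 1), (B n + 1) := Finset.sum_le_sum fun dd _ => hterm dd
        _ = _ := by
          rw [Finset.sum_const, Finset.card_univ, Fintype.card_prod, Fintype.card_fin, smul_eq_mul]
    calc _ ≤ _ := hsum
      _ ≤ (D n + 1) * (D n + 1) * (B n + 1) + (D n + 1) * (D n + 1) := Nat.add_le_add_right hsum' _
      _ = (D n + 1) * (D n + 1) * (B n + 2) := by ring

/-- **The value identity of the two-pinned construction**: substituting `y_j ↦ e_{j+1}(row)` and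
`w_{d,d'} ↦ a^d b^{d'}` into the packaged cores gives `H(a, b; row)`. [folklore] -/
theorem aeval_packagedCores₂_eq {n D : ℕ} (H : MvPolynomial (Option (Option (Fin n))) ℂ)
    (hD : H.degreeOf none ≤ D) (hD' : ∀ d : ℕ, (coeffEps d H).degreeOf none ≤ D)
    (P : ℕ → ℕ → MvPolynomial (Fin n) ℂ)
    (hP : ∀ d d' : ℕ, aeval (fun j : Fin n => esymm (Fin n) ℂ (j.val + 1)) (P d d') =
      coeffEps d' (coeffEps d H))
    {τ : Type} [CommRing τ] [Algebra ℂ τ] (row : Fin n → τ) (a b : τ) :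
    aeval (Sum.elim (fun j : Fin n => aeval row (esymm (Fin n) ℂ (j.val + 1)))
        (fun dd : Fin (D + 1) × Fin (D + 1) => a ^ dd.1.val * b ^ dd.2.val))
      (∑ dd : Fin (D + 1) × Fin (D + 1), X (Sum.inr dd) * rename Sum.inl (P dd.1.val dd.2.val)) =
    aeval (fun o : Option (Option (Fin n)) => o.elim a (fun o' => o'.elim b row)) H := by
  classical
  have hcore : ∀ d d' : ℕ, aeval (fun j : Fin n => aeval row (esymm (Fin n) ℂ (j.val + 1))) (P d d') =
      aeval row (coeffEps d' (coeffEps d H)) := by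
    intro d d'
    rw [← hP d d', ← AlgHom.comp_apply, comp_aeval]
  rw [map_sum]
  have hterm : ∀ dd : Fin (D + 1) × Fin (D + 1),
      aeval (Sum.elim (fun j : Fin n => aeval row (esymm (Fin n) ℂ (j.val + 1)))
        (fun dd : Fin (D + 1) × Fin (D + 1) => a ^ dd.1.val * b ^ dd.2.val))
        (X (Sum.inr dd) * rename Sum.inl (P dd.1.val dd.2.val)) =
      a ^ dd.1.val * (b ^ dd.2.val * aeval row (coeffEps dd.2.val (coeffEps dd.1.val H))) := by
    intro dd
    rw [map_mul, aeval_X, aeval_rename, Sum.elim_inr, mul_assoc, ← hcore dd.1.val dd.2.val]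
    rfl
  have hL : ∑ dd : Fin (D + 1) × Fin (D + 1),
      aeval (Sum.elim (fun j : Fin n => aeval row (esymm (Fin n) ℂ (j.val + 1)))
        (fun dd : Fin (D + 1) × Fin (D + 1) => a ^ dd.1.val * b ^ dd.2.val))
        (X (Sum.inr dd) * rename Sum.inl (P dd.1.val dd.2.val)) =
      ∑ d : Fin (D + 1), ∑ d' : Fin (D + 1),
        a ^ d.val * (b ^ d'.val * aeval row (coeffEps d'.val (coeffEps d.val H))) := by
    rw [Fintype.sum_congr _ _ hterm, Fintype.sum_prod_type]
  rw [hL, Fin.sum_univ_eq_sum_range (fun i => ∑ d' : Fin (D + 1),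
    a ^ i * (b ^ (d' : ℕ) * aeval row (coeffEps d' (coeffEps i H)))) (D + 1)]
  -- right-hand side: slice in `t₁`, then in `t₂`
  conv_rhs => rw [CoefficientSlices.eq_sum_X_pow_mul_rename_coeffEps H hD]
  rw [map_sum]
  refine Finset.sum_congr rfl fun d _ => ?_
  rw [map_mul, map_pow, aeval_X, aeval_rename, ← Finset.mul_sum]
  have hrhs : aeval ((fun o : Option (Option (Fin n)) => o.elim a (fun o' => o'.elim b row)) ∘ some)
      (coeffEps d H) = aeval (fun o' : Option (Fin n) => o'.elim b row) (coeffEps d H) := rfl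
  rw [hrhs]
  show a ^ d * _ = a ^ d * _
  congr 1
  rw [Fin.sum_univ_eq_sum_range (fun i => b ^ i * aeval row (coeffEps i (coeffEps d H))) (D + 1)]
  conv_rhs => rw [CoefficientSlices.eq_sum_X_pow_mul_rename_coeffEps (coeffEps d H) (hD' d)]
  rw [map_sum]
  refine Finset.sum_congr rfl fun d' _ => ?_
  rw [map_mul, map_pow, aeval_X, aeval_rename]
  rfl

/-- ★★ **Two-pinned-entries row gadget.**  For a `VQP` family `H_n ∈ ℂ[t₁, t₂, r_0, …, r_{n-1}]`
(variables `Option (Option (Fin n))`) symmetric in `r`, there are `(1,2)`-label pattern expressions of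
quasi-polynomial length whose value at `(ρ, γ)` is `H_n(x_{ρ0,γ0}, x_{ρ0,γ1}; x_{ρ0,0}, …, x_{ρ0,n-1})`.
[cite: BlaserJindal2019, Thm. 4] -/
theorem exists_twoPinnedEntriesRowGadget (H : (n : ℕ) → MvPolynomial (Option (Option (Fin n))) ℂ)
    (hsymm : ∀ (n : ℕ) (τ : Equiv.Perm (Fin n)), rename (Option.map (Option.map τ)) (H n) = H n)
    (hH : IsVQPFamily H) :
    ∃ c : ℕ, ∀ n : ℕ, 1 ≤ n → ∃ W : PatternExpr ℂ 1 2,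
      W.length ≤ 2 ^ ((Nat.log 2 n + c) ^ c) ∧
      ∀ (ρ : Fin 1 → Fin n) (γ : Fin 2 → Fin n), W.value n ρ γ =
        aeval (fun o : Option (Option (Fin n)) => o.elim (X (ρ 0, γ 0))
          (fun o' => o'.elim (X (ρ 0, γ 1))
            (fun j => (X (ρ 0, j) : MvPolynomial (Fin n × Fin n) ℂ)))) (H n) := by
  classical
  -- degrees
  set D : ℕ → ℕ := fun n => (H n).totalDegree with hDdef
  have hDp : IsPBounded D := hH.1.2
  have hDt : ∀ n, (H n).degreeOf none ≤ D n := fun n => CoefficientSlices.degreeOf_none_le_totalDegree _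
  -- first slices `S₁ n d ∈ ℂ[t₂, r]`, symmetric in `r`
  set S₁ : (n : ℕ) → ℕ → MvPolynomial (Option (Fin n)) ℂ := fun n d => coeffEps d (H n) with hS₁
  have hS₁symm : ∀ n d (τ : Equiv.Perm (Fin n)), rename (Option.map τ) (S₁ n d) = S₁ n d := by
    intro n d τ
    show rename (Option.map τ) (coeffEps d (H n)) = coeffEps d (H n)
    rw [← CoefficientSlices.coeffEps_rename_optionMap, hsymm]
  have hS₁deg : ∀ n d, (S₁ n d).totalDegree ≤ D n := fun n d => CoefficientSlices.totalDegree_coeffEps_le _ _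
  have hS₁t : ∀ n d, (S₁ n d).degreeOf none ≤ D n :=
    fun n d => (CoefficientSlices.degreeOf_none_le_totalDegree _).trans (hS₁deg n d)
  have hS₁c : ∀ n d, d ≤ D n → complexity (S₁ n d) ≤ (D n + 1) * (complexity (H n) + 2) + 1 :=
    fun n d hd => CoefficientSlices.complexity_coeffEps_le (H n) (hDt n) hd
  -- cores of the second slices
  choose P hP using fun n d => exists_sliceCores (S₁ n d) (hS₁symm n d)
  obtain ⟨cBJ, hBJ⟩ := exists_complexity_sliceCore_le
  set B : ℕ → ℕ := fun n =>
    ((D n + 1) * (((D n + 1) * (complexity (H n) + 2) + 1) + 2) + 1 + D n + n + 2) ^ cBJ with hBdef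
  have hPc : ∀ n d d', d ≤ D n → d' ≤ D n → complexity (P n d d') ≤ B n := by
    intro n d d' hd hd'
    refine (hBJ n (S₁ n d) (P n d d') (D n) d' (hS₁t n d) hd' (hP n d d')).trans
      (Nat.pow_le_pow_left ?_ cBJ)
    have h1 := hS₁c n d hd
    have h2 := hS₁deg n d
    have h3 : (D n + 1) * (complexity (S₁ n d) + 2) ≤
        (D n + 1) * (((D n + 1) * (complexity (H n) + 2) + 1) + 2) := Nat.mul_le_mul_left _ (by omega)
    omega
  have hPd : ∀ n d d', (P n d d').totalDegree ≤ D n :=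
    fun n d d' => (totalDegree_sliceCore_le (S₁ n d) (P n d d') d' (hP n d d')).trans (hS₁deg n d)
  -- the packaged family
  set Q : (n : ℕ) → MvPolynomial (Fin n ⊕ (Fin (D n + 1) × Fin (D n + 1))) ℂ := fun n =>
    ∑ dd : Fin (D n + 1) × Fin (D n + 1), X (Sum.inr dd) * rename Sum.inl (P n dd.1.val dd.2.val)
    with hQdef
  have hBq : IsQPBounded B := by
    have hDq : IsQPBounded D := hDp.isQPBounded
    have hD1 : IsQPBounded fun n => D n + 1 := hDq.add (IsQPBounded.const 1)
    have hL : IsQPBounded fun n => complexity (H n) := hH.2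
    exact (((((hD1.mul (((hD1.mul (hL.add (IsQPBounded.const 2))).add (IsQPBounded.const 1)).add
      (IsQPBounded.const 2))).add (IsQPBounded.const 1)).add hDq).add
        (IsPBounded.id.isQPBounded)).add (IsQPBounded.const 2)).pow cBJ
  have hQ : IsVQPFamily Q := isVQPFamily_packagedCores₂ D hDp P B hBq hPc hPd
  -- substituends
  choose E hE using fun n : ℕ => exists_rowEsymm n n
  choose Epad hEpadl hEpadv using fun (n : ℕ) (j : ℕ) =>
    NarrowClosure.exists_value_eq_pad (F := ℂ) (k := 1) (l := 1) (K := 1) (L := 2) le_rfl (by norm_num) n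
      (E n j)
  choose Epw₀ hEpw₀l hEpw₀v using fun d : ℕ => exists_edge_pow (F := ℂ) (k := 1) (l := 2) 0 0 d
  choose Epw₁ hEpw₁l hEpw₁v using fun d : ℕ => exists_edge_pow (F := ℂ) (k := 1) (l := 2) 0 1 d
  set θ : (n : ℕ) → Fin n ⊕ (Fin (D n + 1) × Fin (D n + 1)) → PatternExpr ℂ 1 2 := fun n =>
    Sum.elim (fun j => Epad n (j.val + 1)) (fun dd => PatternExpr.mul (Epw₀ dd.1.val) (Epw₁ dd.2.val))
    with hθdef
  have hθ : ∃ c : ℕ, ∀ n : ℕ, 1 ≤ n → ∀ i, (θ n i).length ≤ 2 ^ ((Nat.log 2 n + c) ^ c) := by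
    obtain ⟨c₁, hc₁⟩ := esymm_subst_length_qp 1
    obtain ⟨a, ha⟩ := hDp
    obtain ⟨c₂, hc₂⟩ := NarrowClosure.qp_combine (a + 1) 0
    refine ⟨max c₁ c₂, fun n hn i => ?_⟩
    rcases i with j | dd
    · have h1 := (hE n (j.val + 1) (by have := j.isLt; omega)).1
      have h2 := hc₁ n n (by simp)
      calc (θ n (Sum.inl j)).length = (E n (j.val + 1)).length := hEpadl n (j.val + 1)
        _ ≤ (2 * (n + 1) + 2) ^ (Nat.log 2 n + 1) * ((2 * n + 3) + 2 + (n + 1) + 1) :=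
            h1.trans (Nat.mul_le_mul_left _ (by omega))
        _ ≤ 2 ^ ((Nat.log 2 n + c₁) ^ c₁) := h2
        _ ≤ 2 ^ ((Nat.log 2 n + max c₁ c₂) ^ max c₁ c₂) :=
            Nat.pow_le_pow_right (by norm_num) (CompressionFloors.polylog_mono (le_max_left _ _))
    · have hd : dd.1.val ≤ D n := by have := dd.1.isLt; omega
      have hd' : dd.2.val ≤ D n := by have := dd.2.isLt; omega
      have hX : n ^ a + a ≤ 2 ^ ((Nat.log 2 n + (a + 1)) ^ (a + 1)) := CompressionFloors.pbounded_le_qp n a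
      have h3 := hc₂ (Nat.log 2 n) (n ^ a + a) 2 hX (by norm_num)
      have h4 := ha n
      calc (θ n (Sum.inr dd)).length = (2 * dd.1.val + 1) + (2 * dd.2.val + 1) + 1 := by
            show (PatternExpr.mul (Epw₀ dd.1.val) (Epw₁ dd.2.val)).length = _
            simp [PatternExpr.length, hEpw₀l, hEpw₁l]
        _ ≤ (n ^ a + a + 2) * (2 + 2) := by omega
        _ ≤ 2 ^ ((Nat.log 2 n + c₂) ^ c₂) := h3
        _ ≤ 2 ^ ((Nat.log 2 n + max c₁ c₂) ^ max c₁ c₂) :=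
            Nat.pow_le_pow_right (by norm_num) (CompressionFloors.polylog_mono (le_max_right _ _))
  obtain ⟨c, hc⟩ := exists_narrow_subst_of_isVQPFamily_general
    (ι := fun n => Fin n ⊕ (Fin (D n + 1) × Fin (D n + 1))) Q hQ (k := fun _ => 1) (l := fun _ => 2) θ hθ
  refine ⟨c, fun n hn => ?_⟩
  obtain ⟨e, hl, hv⟩ := hc n hn
  refine ⟨e, hl, fun ρ γ => ?_⟩
  rw [hv]
  have hθv : (fun i => (θ n i).value n ρ γ) =
      Sum.elim (fun j : Fin n => aeval (fun j : Fin n => (X (ρ 0, j) : MvPolynomial (Fin n × Fin n) ℂ))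
          (esymm (Fin n) ℂ (j.val + 1)))
        (fun dd : Fin (D n + 1) × Fin (D n + 1) =>
          (X (ρ 0, γ 0) : MvPolynomial (Fin n × Fin n) ℂ) ^ dd.1.val * X (ρ 0, γ 1) ^ dd.2.val) := by
    funext i
    rcases i with j | dd
    · show (Epad n (j.val + 1)).value n ρ γ = _
      rw [hEpadv, (hE n (j.val + 1) (by have := j.isLt; omega)).2]
      rfl
    · show (PatternExpr.mul (Epw₀ dd.1.val) (Epw₁ dd.2.val)).value n ρ γ = _
      rw [PatternExpr.value_mul, hEpw₀v, hEpw₁v]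
      rfl
  rw [hθv]
  exact aeval_packagedCores₂_eq (H n) (hDt n) (hS₁t n) (P n) (hP n)
    (fun j : Fin n => (X (ρ 0, j) : MvPolynomial (Fin n × Fin n) ℂ)) (X (ρ 0, γ 0)) (X (ρ 0, γ 1))

/-- ★ **The 2-row stratum for second-row-quadratic inner polynomials.**  For a `VQP` family
`H_n ∈ ℂ[t₁, t₂, r_0, …, r_{n-1}]` symmetric in `r`, the matrix-symmetric family
`f_n = Σ_i Σ_{b,b'} (Σ_{i'} x_{i'b} x_{i'b'}) · H_n(x_{ib}, x_{ib'}; row i) = Σ_{i,i'} g_n(row i, row i')`,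
`g_n(r, s) = Σ_{b,b'} s_b s_{b'} H_n(r_b, r_{b'}; r)`, satisfies the conclusion of
`stub_narrowExpressionCompression` (with `(2,2)` labels). [cite: BlaserJindal2019, Thm. 4] -/
theorem narrowQP_twoRow_pinnedQuadratic (H : (n : ℕ) → MvPolynomial (Option (Option (Fin n))) ℂ)
    (hsymm : ∀ (n : ℕ) (τ : Equiv.Perm (Fin n)), rename (Option.map (Option.map τ)) (H n) = H n)
    (hH : IsVQPFamily H) :
    ∃ c : ℕ, ∀ n : ℕ, 1 ≤ n → ∃ (k l : ℕ) (e : PatternExpr ℂ k l),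
      n ^ (k + l) ≤ 2 ^ ((Nat.log 2 n + c) ^ c) ∧ e.length ≤ 2 ^ ((Nat.log 2 n + c) ^ c) ∧
      e.close n = ∑ i : Fin n, ∑ b : Fin n, ∑ b' : Fin n,
        (∑ i' : Fin n, (X (i', b) : MvPolynomial (Fin n × Fin n) ℂ) * X (i', b')) *
        aeval (fun o : Option (Option (Fin n)) => o.elim (X (i, b))
          (fun o' => o'.elim (X (i, b'))
            (fun j => (X (i, j) : MvPolynomial (Fin n × Fin n) ℂ)))) (H n) := by
  classical
  obtain ⟨c₁, hc₁⟩ := exists_twoPinnedEntriesRowGadget H hsymm hH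
  obtain ⟨c₂, hc₂⟩ := NarrowClosure.qp_combine c₁ 0
  refine ⟨max c₂ 5, fun n hn => ?_⟩
  obtain ⟨W, hWl, hWv⟩ := hc₁ n hn
  obtain ⟨W', hW'l, hW'v⟩ :=
    NarrowClosure.exists_value_eq_pad (F := ℂ) (k := 1) (l := 2) (K := 2) (L := 2) (by norm_num) le_rfl n W
  set G : Fin n → Fin n → Fin n → MvPolynomial (Fin n × Fin n) ℂ := fun i b b' =>
    aeval (fun o : Option (Option (Fin n)) => o.elim (X (i, b))
      (fun o' => o'.elim (X (i, b'))
        (fun j => (X (i, j) : MvPolynomial (Fin n × Fin n) ℂ)))) (H n) with hG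
  have hW'G : ∀ (ρ : Fin 2 → Fin n) (γ : Fin 2 → Fin n), W'.value n ρ γ = G (ρ 0) (γ 0) (γ 1) := by
    intro ρ γ
    rw [hW'v, hWv]
    rfl
  set e₁ : PatternExpr ℂ 2 2 :=
    PatternExpr.mul (PatternExpr.sumRow 1 (PatternExpr.mul (PatternExpr.edge 1 0) (PatternExpr.edge 1 1))) W'
    with he₁
  set e₂ : PatternExpr ℂ 2 2 := PatternExpr.sumCol 1 e₁ with he₂
  set e₃ : PatternExpr ℂ 2 2 := PatternExpr.sumCol 0 e₂ with he₃
  set e₄ : PatternExpr ℂ 2 2 := PatternExpr.sumRow 0 e₃ with he₄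
  have hv₁ : ∀ (ρ : Fin 2 → Fin n) (γ : Fin 2 → Fin n), e₁.value n ρ γ =
      (∑ i' : Fin n, (X (i', γ 0) : MvPolynomial (Fin n × Fin n) ℂ) * X (i', γ 1)) *
        G (ρ 0) (γ 0) (γ 1) := by
    intro ρ γ
    simp only [he₁, PatternExpr.value_mul, PatternExpr.value_sumRow, PatternExpr.value_edge,
      Function.update_self, hW'G]
  have hv₂ : ∀ (ρ : Fin 2 → Fin n) (γ : Fin 2 → Fin n), e₂.value n ρ γ =
      ∑ b' : Fin n, (∑ i' : Fin n, (X (i', γ 0) : MvPolynomial (Fin n × Fin n) ℂ) * X (i', b')) *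
        G (ρ 0) (γ 0) b' := by
    intro ρ γ
    simp only [he₂, PatternExpr.value_sumCol, hv₁, Function.update_self]
    refine Finset.sum_congr rfl fun b' _ => ?_
    simp
  have hv₃ : ∀ (ρ : Fin 2 → Fin n) (γ : Fin 2 → Fin n), e₃.value n ρ γ =
      ∑ b : Fin n, ∑ b' : Fin n, (∑ i' : Fin n, (X (i', b) : MvPolynomial (Fin n × Fin n) ℂ) * X (i', b')) *
        G (ρ 0) b b' := by
    intro ρ γ
    simp only [he₃, PatternExpr.value_sumCol, hv₂, Function.update_self]
  have hv₄ : ∀ (ρ : Fin 2 → Fin n) (γ : Fin 2 → Fin n), e₄.value n ρ γ =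
      ∑ i : Fin n, ∑ b : Fin n, ∑ b' : Fin n,
        (∑ i' : Fin n, (X (i', b) : MvPolynomial (Fin n × Fin n) ℂ) * X (i', b')) * G i b b' := by
    intro ρ γ
    simp only [he₄, PatternExpr.value_sumRow, hv₃, Function.update_self]
  obtain ⟨e₅, hl₅, hc₅⟩ := exists_close_eq_of_value_const_kl hn e₄ _ hv₄
  refine ⟨2, 2, e₅, ?_, ?_, by rw [hc₅]⟩
  · calc n ^ (2 + 2) ≤ n ^ 4 + 4 := by norm_num
      _ ≤ 2 ^ ((Nat.log 2 n + 5) ^ 5) := CompressionFloors.pbounded_le_qp n 4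
      _ ≤ 2 ^ ((Nat.log 2 n + max c₂ 5) ^ max c₂ 5) :=
          Nat.pow_le_pow_right (by norm_num) (CompressionFloors.polylog_mono (le_max_right _ _))
  · have h := hc₂ (Nat.log 2 n) W.length 2 hWl (by norm_num)
    have hpos := PatternExpr.length_pos W
    calc e₅.length = W.length + 10 := by
          rw [hl₅, he₄, he₃, he₂, he₁]; simp [PatternExpr.length, hW'l]; ring
      _ ≤ (W.length + 2) * (2 + 2) := by omega
      _ ≤ 2 ^ ((Nat.log 2 n + c₂) ^ c₂) := h
      _ ≤ 2 ^ ((Nat.log 2 n + max c₂ 5) ^ max c₂ 5) :=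
          Nat.pow_le_pow_right (by norm_num) (CompressionFloors.polylog_mono (le_max_left _ _))

/-- The `VP` case of the second-row-quadratic 2-row stratum. [cite: BlaserJindal2019, Thm. 4] -/
theorem narrowQP_twoRow_pinnedQuadratic_of_VP (H : (n : ℕ) → MvPolynomial (Option (Option (Fin n))) ℂ)
    (hsymm : ∀ (n : ℕ) (τ : Equiv.Perm (Fin n)), rename (Option.map (Option.map τ)) (H n) = H n)
    (hH : IsVPFamily H) :
    ∃ c : ℕ, ∀ n : ℕ, 1 ≤ n → ∃ (k l : ℕ) (e : PatternExpr ℂ k l),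
      n ^ (k + l) ≤ 2 ^ ((Nat.log 2 n + c) ^ c) ∧ e.length ≤ 2 ^ ((Nat.log 2 n + c) ^ c) ∧
      e.close n = ∑ i : Fin n, ∑ b : Fin n, ∑ b' : Fin n,
        (∑ i' : Fin n, (X (i', b) : MvPolynomial (Fin n × Fin n) ℂ) * X (i', b')) *
        aeval (fun o : Option (Option (Fin n)) => o.elim (X (i, b))
          (fun o' => o'.elim (X (i, b'))
            (fun j => (X (i, j) : MvPolynomial (Fin n × Fin n) ℂ)))) (H n) :=
  narrowQP_twoRow_pinnedQuadratic H hsymm hH.isVQPFamily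

end FormulaSubstitution

end Summit.ValiantsHypothesis.ValiantsHypothesis.Theorems

end
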